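import Mathlib.Tactic.Ring
import Mathlib.Tactic.Linarith
import Mathlib.Tactic.Positivity
import Mathlib.Tactic.LinearCombination
import Mathlib.Tactic.FinCases
import Mathlib.Data.Real.Basic
import Mathlib.Data.Fin.VecNotation
import Mathlib.Algebra.BigOperators.Fin
import Summits.HodgeConjecture.HodgeConjecture.Theorems.WeilClassTestChargeZeroHyperplane
import HarnessLib

/-!
# Conjecture N (hodge-weil ladder, GAPS G51b/G51c), format (5,3): `Q₂ ≥ 0` (Lemma N₂′ kernel-complete) and `G_λ ≥ 0` whenever `Q₄ ≥ 0`

Prover 2, generation 15 (note `run/shared/lean/b2b/hodge-weil/b2b-hweil-pv2-g15/DIVIDED-DIFFERENCE-G15.md` §3). Setting of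
`CONJECTURE-N.md` §1 in format (5,3) (E-roots `(A_e, u_e)`, `e = 1..5`; F-roots `(B_g, v_g)`, `g = 1..3`; centred coordinates;
`Q₂ = ½S_AS_u + S_Au² − 3S_{A²u²}`, `Q₄ = 3S_{u⁴} − (3/2)S_u²`). pv2-g8's LEMMA N₂′ (`CHARGE-ZERO-LEMMA.md` §4): centring + (P1) + (P3)
(= (P2) for real charges) + N-dominance `B_g ≤ A_e` ⟹ `Q₂ ≥ 0`, in every format; its kernel proof consisted of THEOREM 1
(`Literature/…/WeilClassTestChargeZeroLemmaAssembly.lean`) plus three dictionary steps. Steps 1–2 for format (5,3) are the two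
`linear_combination` identities below (`stepOne_53`, `stepTwo_53`, verbatim analogues of `stepOne_64`/`stepTwo_64`), Step 3 is
`WeilClassTestChargeZeroHyperplane.core_form_nonneg_of_nonneg`; the assembly `Q2_nonneg_53` applies it to the eight atoms
`p = (A_e − s; s − B_g)`, `x = (A_e − s; B_g − s)`, `g = (u_e; v_g)` with `s = max_g B_g`, `T = −2s`. CONSEQUENCE for the variational lane
(`conjectureN_53_of_Q4_nonneg`): every centred, pure, pairwise-ample real (5,3) configuration with `Q₄ ≥ 0` satisfies `Q₂ + λQ₄ ≥ 0` for all
`λ ≥ 0` — Conjecture N in format (5,3) (any constant) is thereby reduced to the configurations with `Q₄ < 0`, i.e. (by the collinearity of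
`(v_g, K₀(g))`, `WeilClassTestFormatFiveThreeProductFormula.lean`) to the charge patterns in which the numbers of E-charges below the three
F-charges have parities `000, 001, 011` or `111`. Pure algebra; nothing here is a case of HC, a rung or a door edge; no statement of Markman's
papers is used. New cell result ⇒ Summits/.
-/

set_option linter.dupNamespace false

open Finset
open Summit.HodgeConjecture.HodgeConjecture.WeilClassTestChargeZeroHyperplane

namespace Summit.HodgeConjecture.HodgeConjecture.WeilClassTestFormatFiveThreeQ2

/-- STEP 1 (format (5,3)): the multiplier identity `T·Q₂ = (Σb² − Σd² + T²)·W + T·L² − 3T·M₂` under centring of the positions and (P3),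
with `b_e = A_e − s`, `d_g = s − B_g`, `T = −2s` (any real `s`). -/
theorem stepOne_53 (A₁ A₂ A₃ A₄ A₅ B₁ B₂ B₃ u₁ u₂ u₃ u₄ u₅ v₁ v₂ v₃ : ℝ) (s : ℝ)
    (hA : A₁ + A₂ + A₃ + A₄ + A₅ = B₁ + B₂ + B₃)
    (hP3 : A₁ * u₁ ^ 2 + A₂ * u₂ ^ 2 + A₃ * u₃ ^ 2 + A₄ * u₄ ^ 2 + A₅ * u₅ ^ 2 = B₁ * v₁ ^ 2 + B₂ * v₂ ^ 2 + B₃ * v₃ ^ 2) :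
    (-2 * s) * ((1 / 2) * ((A₁ ^ 2 + A₂ ^ 2 + A₃ ^ 2 + A₄ ^ 2 + A₅ ^ 2) - (B₁ ^ 2 + B₂ ^ 2 + B₃ ^ 2)) * ((u₁ ^ 2 + u₂ ^ 2 + u₃ ^ 2 + u₄ ^ 2 + u₅ ^ 2) - (v₁ ^ 2 + v₂ ^ 2 + v₃ ^ 2))
        + ((A₁ * u₁ + A₂ * u₂ + A₃ * u₃ + A₄ * u₄ + A₅ * u₅) - (B₁ * v₁ + B₂ * v₂ + B₃ * v₃)) ^ 2
        - 3 * ((A₁ ^ 2 * u₁ ^ 2 + A₂ ^ 2 * u₂ ^ 2 + A₃ ^ 2 * u₃ ^ 2 + A₄ ^ 2 * u₄ ^ 2 + A₅ ^ 2 * u₅ ^ 2) - (B₁ ^ 2 * v₁ ^ 2 + B₂ ^ 2 * v₂ ^ 2 + B₃ ^ 2 * v₃ ^ 2)))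
      = ((((A₁ - s) ^ 2 + (A₂ - s) ^ 2 + (A₃ - s) ^ 2 + (A₄ - s) ^ 2 + (A₅ - s) ^ 2) - ((s - B₁) ^ 2 + (s - B₂) ^ 2 + (s - B₃) ^ 2)) + (-2 * s) ^ 2)
          * (((A₁ - s) * u₁ ^ 2 + (A₂ - s) * u₂ ^ 2 + (A₃ - s) * u₃ ^ 2 + (A₄ - s) * u₄ ^ 2 + (A₅ - s) * u₅ ^ 2
              + ((s - B₁) * v₁ ^ 2 + (s - B₂) * v₂ ^ 2 + (s - B₃) * v₃ ^ 2)))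
        + (-2 * s) * ((A₁ * u₁ + A₂ * u₂ + A₃ * u₃ + A₄ * u₄ + A₅ * u₅) - (B₁ * v₁ + B₂ * v₂ + B₃ * v₃)) ^ 2
        - 3 * (-2 * s) * (((A₁ - s) ^ 2 * u₁ ^ 2 + (A₂ - s) ^ 2 * u₂ ^ 2 + (A₃ - s) ^ 2 * u₃ ^ 2 + (A₄ - s) ^ 2 * u₄ ^ 2 + (A₅ - s) ^ 2 * u₅ ^ 2)
            - ((s - B₁) ^ 2 * v₁ ^ 2 + (s - B₂) ^ 2 * v₂ ^ 2 + (s - B₃) ^ 2 * v₃ ^ 2)) := by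
  linear_combination (-((A₁ ^ 2 + A₂ ^ 2 + A₃ ^ 2 + A₄ ^ 2 + A₅ ^ 2) - (B₁ ^ 2 + B₂ ^ 2 + B₃ ^ 2)) + 6 * s ^ 2 + 2 * s * ((A₁ + A₂ + A₃ + A₄ + A₅) - (B₁ + B₂ + B₃))) * hP3
    + (-(2 * s ^ 2 * ((u₁ ^ 2 + u₂ ^ 2 + u₃ ^ 2 + u₄ ^ 2 + u₅ ^ 2) - (v₁ ^ 2 + v₂ ^ 2 + v₃ ^ 2)))) * hA

/-- STEP 2 (format (5,3)): the hyperplane identity `Σb²u − Σd²v = T·(Σbu + Σdv)` under centring of the charges and (P1). -/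
theorem stepTwo_53 (A₁ A₂ A₃ A₄ A₅ B₁ B₂ B₃ u₁ u₂ u₃ u₄ u₅ v₁ v₂ v₃ : ℝ) (s : ℝ)
    (hC : u₁ + u₂ + u₃ + u₄ + u₅ = v₁ + v₂ + v₃)
    (hP1 : A₁ ^ 2 * u₁ + A₂ ^ 2 * u₂ + A₃ ^ 2 * u₃ + A₄ ^ 2 * u₄ + A₅ ^ 2 * u₅ = B₁ ^ 2 * v₁ + B₂ ^ 2 * v₂ + B₃ ^ 2 * v₃) :
    (((A₁ - s) ^ 2 * u₁ + (A₂ - s) ^ 2 * u₂ + (A₃ - s) ^ 2 * u₃ + (A₄ - s) ^ 2 * u₄ + (A₅ - s) ^ 2 * u₅) - ((s - B₁) ^ 2 * v₁ + (s - B₂) ^ 2 * v₂ + (s - B₃) ^ 2 * v₃))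
      = (-2 * s) * (((A₁ - s) * u₁ + (A₂ - s) * u₂ + (A₃ - s) * u₃ + (A₄ - s) * u₄ + (A₅ - s) * u₅) + ((s - B₁) * v₁ + (s - B₂) * v₂ + (s - B₃) * v₃)) := by
  linear_combination hP1 - s ^ 2 * hC

/-- `core_form_nonneg_of_nonneg` for EIGHT explicit atoms (the (5,3) format has `5 + 3` roots). -/
theorem core_form_nonneg_eight (p₁ p₂ p₃ p₄ p₅ p₆ p₇ p₈ x₁ x₂ x₃ x₄ x₅ x₆ x₇ x₈ g₁ g₂ g₃ g₄ g₅ g₆ g₇ g₈ T M : ℝ)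
    (hp₁ : 0 ≤ p₁) (hp₂ : 0 ≤ p₂) (hp₃ : 0 ≤ p₃) (hp₄ : 0 ≤ p₄) (hp₅ : 0 ≤ p₅) (hp₆ : 0 ≤ p₆) (hp₇ : 0 ≤ p₇) (hp₈ : 0 ≤ p₈)
    (hx₁ : |x₁| ≤ p₁) (hx₂ : |x₂| ≤ p₂) (hx₃ : |x₃| ≤ p₃) (hx₄ : |x₄| ≤ p₄) (hx₅ : |x₅| ≤ p₅) (hx₆ : |x₆| ≤ p₆)
    (hx₇ : |x₇| ≤ p₇) (hx₈ : |x₈| ≤ p₈)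
    (hT : T = p₁ + p₂ + p₃ + p₄ + p₅ + p₆ + p₇ + p₈)
    (hM : M = x₁ * p₁ + x₂ * p₂ + x₃ * p₃ + x₄ * p₄ + x₅ * p₅ + x₆ * p₆ + x₇ * p₇ + x₈ * p₈)
    (hg : p₁ * (T - x₁) * g₁ + p₂ * (T - x₂) * g₂ + p₃ * (T - x₃) * g₃ + p₄ * (T - x₄) * g₄ + p₅ * (T - x₅) * g₅ + p₆ * (T - x₆) * g₆ + p₇ * (T - x₇) * g₇ + p₈ * (T - x₈) * g₈ = 0) :
    0 ≤ (p₁ * (T ^ 2 + M - 3 * T * x₁) * g₁ ^ 2 + p₂ * (T ^ 2 + M - 3 * T * x₂) * g₂ ^ 2 + p₃ * (T ^ 2 + M - 3 * T * x₃) * g₃ ^ 2 + p₄ * (T ^ 2 + M - 3 * T * x₄) * g₄ ^ 2 + p₅ * (T ^ 2 + M - 3 * T * x₅) * g₅ ^ 2 + p₆ * (T ^ 2 + M - 3 * T * x₆) * g₆ ^ 2 + p₇ * (T ^ 2 + M - 3 * T * x₇) * g₇ ^ 2 + p₈ * (T ^ 2 + M - 3 * T * x₈) * g₈ ^ 2)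
      + T * (p₁ * g₁ + p₂ * g₂ + p₃ * g₃ + p₄ * g₄ + p₅ * g₅ + p₆ * g₆ + p₇ * g₇ + p₈ * g₈) ^ 2 := by
  have h := core_form_nonneg_of_nonneg (ι := Fin 8) ![p₁, p₂, p₃, p₄, p₅, p₆, p₇, p₈] ![x₁, x₂, x₃, x₄, x₅, x₆, x₇, x₈]
    (by intro k; fin_cases k <;> simpa) (by intro k; fin_cases k <;> simpa) T M
    (by rw [hT]; simp [Fin.sum_univ_eight]) (by rw [hM]; simp [Fin.sum_univ_eight])
    (fun k => T ^ 2 + M - 3 * T * (![x₁, x₂, x₃, x₄, x₅, x₆, x₇, x₈] : Fin 8 → ℝ) k) (fun k => rfl)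
    ![g₁, g₂, g₃, g₄, g₅, g₆, g₇, g₈]
    (by simp [Fin.sum_univ_eight]; linear_combination hg)
  simp [Fin.sum_univ_eight] at h
  linear_combination h

/-- **LEMMA N₂′ IN FORMAT (5,3), kernel-complete.** Centred positions and charges, (P1), (P3) and weak N-dominance `B_g ≤ A_e` ⟹ `Q₂ ≥ 0`. -/
theorem Q2_nonneg_53 (A₁ A₂ A₃ A₄ A₅ B₁ B₂ B₃ u₁ u₂ u₃ u₄ u₅ v₁ v₂ v₃ : ℝ)
    (hA : A₁ + A₂ + A₃ + A₄ + A₅ = B₁ + B₂ + B₃) (hC : u₁ + u₂ + u₃ + u₄ + u₅ = v₁ + v₂ + v₃)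
    (hP1 : (A₁ ^ 2 * u₁ + A₂ ^ 2 * u₂ + A₃ ^ 2 * u₃ + A₄ ^ 2 * u₄ + A₅ ^ 2 * u₅) - (B₁ ^ 2 * v₁ + B₂ ^ 2 * v₂ + B₃ ^ 2 * v₃) = 0)
    (hP2 : (A₁ * u₁ ^ 2 + A₂ * u₂ ^ 2 + A₃ * u₃ ^ 2 + A₄ * u₄ ^ 2 + A₅ * u₅ ^ 2) - (B₁ * v₁ ^ 2 + B₂ * v₂ ^ 2 + B₃ * v₃ ^ 2) = 0)
    (d₁₁ : B₁ ≤ A₁) (d₂₁ : B₁ ≤ A₂) (d₃₁ : B₁ ≤ A₃) (d₄₁ : B₁ ≤ A₄) (d₅₁ : B₁ ≤ A₅)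
    (d₁₂ : B₂ ≤ A₁) (d₂₂ : B₂ ≤ A₂) (d₃₂ : B₂ ≤ A₃) (d₄₂ : B₂ ≤ A₄) (d₅₂ : B₂ ≤ A₅)
    (d₁₃ : B₃ ≤ A₁) (d₂₃ : B₃ ≤ A₂) (d₃₃ : B₃ ≤ A₃) (d₄₃ : B₃ ≤ A₄) (d₅₃ : B₃ ≤ A₅)
    :
    0 ≤ (1 / 2) * ((A₁ ^ 2 + A₂ ^ 2 + A₃ ^ 2 + A₄ ^ 2 + A₅ ^ 2) - (B₁ ^ 2 + B₂ ^ 2 + B₃ ^ 2)) * ((u₁ ^ 2 + u₂ ^ 2 + u₃ ^ 2 + u₄ ^ 2 + u₅ ^ 2) - (v₁ ^ 2 + v₂ ^ 2 + v₃ ^ 2))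
        + ((A₁ * u₁ + A₂ * u₂ + A₃ * u₃ + A₄ * u₄ + A₅ * u₅) - (B₁ * v₁ + B₂ * v₂ + B₃ * v₃)) ^ 2
        - 3 * ((A₁ ^ 2 * u₁ ^ 2 + A₂ ^ 2 * u₂ ^ 2 + A₃ ^ 2 * u₃ ^ 2 + A₄ ^ 2 * u₄ ^ 2 + A₅ ^ 2 * u₅ ^ 2) - (B₁ ^ 2 * v₁ ^ 2 + B₂ ^ 2 * v₂ ^ 2 + B₃ ^ 2 * v₃ ^ 2)) := by
  -- s = max B, T = −2s
  set s : ℝ := max (max B₁ B₂) B₃ with hs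
  have hB₁ : B₁ ≤ s := le_trans (le_max_left _ _) (le_max_left _ _)
  have hB₂ : B₂ ≤ s := le_trans (le_max_right _ _) (le_max_left _ _)
  have hB₃ : B₃ ≤ s := le_max_right _ _
  have hA₁ : s ≤ A₁ := max_le (max_le d₁₁ d₁₂) d₁₃
  have hA₂ : s ≤ A₂ := max_le (max_le d₂₁ d₂₂) d₂₃
  have hA₃ : s ≤ A₃ := max_le (max_le d₃₁ d₃₂) d₃₃
  have hA₄ : s ≤ A₄ := max_le (max_le d₄₁ d₄₂) d₄₃
  have hA₅ : s ≤ A₅ := max_le (max_le d₅₁ d₅₂) d₅₃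
  -- T = −2s ≥ 0; if T = 0 every position is 0 and Q₂ = 0
  have hTnn : 0 ≤ -2 * s := by linarith
  rcases eq_or_lt_of_le hTnn with hT0 | hTpos
  · clear hP1 hP2 hC
    have e₁ : A₁ = 0 := by linarith
    have e₂ : A₂ = 0 := by linarith
    have e₃ : A₃ = 0 := by linarith
    have e₄ : A₄ = 0 := by linarith
    have e₅ : A₅ = 0 := by linarith
    have f₁ : B₁ = 0 := by linarith
    have f₂ : B₂ = 0 := by linarith
    have f₃ : B₃ = 0 := by linarith
    rw [e₁, e₂, e₃, e₄, e₅, f₁, f₂, f₃]; ring_nf; positivity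
  have h2 := stepTwo_53 A₁ A₂ A₃ A₄ A₅ B₁ B₂ B₃ u₁ u₂ u₃ u₄ u₅ v₁ v₂ v₃ s hC (by linarith [hP1])
  have h1 := stepOne_53 A₁ A₂ A₃ A₄ A₅ B₁ B₂ B₃ u₁ u₂ u₃ u₄ u₅ v₁ v₂ v₃ s hA (by linarith [hP2])
  have hcore := core_form_nonneg_eight (A₁ - s) (A₂ - s) (A₃ - s) (A₄ - s) (A₅ - s) (s - B₁) (s - B₂) (s - B₃)
    (A₁ - s) (A₂ - s) (A₃ - s) (A₄ - s) (A₅ - s) (B₁ - s) (B₂ - s) (B₃ - s) u₁ u₂ u₃ u₄ u₅ v₁ v₂ v₃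
    (-2 * s) (((A₁ - s) ^ 2 + (A₂ - s) ^ 2 + (A₃ - s) ^ 2 + (A₄ - s) ^ 2 + (A₅ - s) ^ 2) - ((s - B₁) ^ 2 + (s - B₂) ^ 2 + (s - B₃) ^ 2))
    (by linarith) (by linarith) (by linarith) (by linarith) (by linarith) (by linarith) (by linarith) (by linarith)
    (by rw [abs_of_nonneg (by linarith)]) (by rw [abs_of_nonneg (by linarith)]) (by rw [abs_of_nonneg (by linarith)])
    (by rw [abs_of_nonneg (by linarith)]) (by rw [abs_of_nonneg (by linarith)])
    (by rw [abs_of_nonpos (by linarith)]; linarith) (by rw [abs_of_nonpos (by linarith)]; linarith)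
    (by rw [abs_of_nonpos (by linarith)]; linarith)
    (by linarith) (by ring) (by linear_combination (-1 : ℝ) * h2)
  have hsum : (A₁ - s) * u₁ + (A₂ - s) * u₂ + (A₃ - s) * u₃ + (A₄ - s) * u₄ + (A₅ - s) * u₅ + (s - B₁) * v₁ + (s - B₂) * v₂ + (s - B₃) * v₃
      = ((A₁ * u₁ + A₂ * u₂ + A₃ * u₃ + A₄ * u₄ + A₅ * u₅) - (B₁ * v₁ + B₂ * v₂ + B₃ * v₃)) := by linear_combination (-s) * hC
  rw [hsum] at hcore
  -- Step 1: (−2s)·Q₂ equals the core form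
  have hcore' : 0 ≤ (-2 * s) * ((1 / 2) * ((A₁ ^ 2 + A₂ ^ 2 + A₃ ^ 2 + A₄ ^ 2 + A₅ ^ 2) - (B₁ ^ 2 + B₂ ^ 2 + B₃ ^ 2)) * ((u₁ ^ 2 + u₂ ^ 2 + u₃ ^ 2 + u₄ ^ 2 + u₅ ^ 2) - (v₁ ^ 2 + v₂ ^ 2 + v₃ ^ 2))
        + ((A₁ * u₁ + A₂ * u₂ + A₃ * u₃ + A₄ * u₄ + A₅ * u₅) - (B₁ * v₁ + B₂ * v₂ + B₃ * v₃)) ^ 2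
        - 3 * ((A₁ ^ 2 * u₁ ^ 2 + A₂ ^ 2 * u₂ ^ 2 + A₃ ^ 2 * u₃ ^ 2 + A₄ ^ 2 * u₄ ^ 2 + A₅ ^ 2 * u₅ ^ 2) - (B₁ ^ 2 * v₁ ^ 2 + B₂ ^ 2 * v₂ ^ 2 + B₃ ^ 2 * v₃ ^ 2))) := by
    rw [h1]; linear_combination hcore
  exact (mul_nonneg_iff_of_pos_left hTpos).mp hcore'

/-- Lemma N₂′ in format (5,3) under PAIRWISE AMPLENESS (which implies N-dominance). -/
theorem Q2_nonneg_53_ample (A₁ A₂ A₃ A₄ A₅ B₁ B₂ B₃ u₁ u₂ u₃ u₄ u₅ v₁ v₂ v₃ : ℝ)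
    (hA : A₁ + A₂ + A₃ + A₄ + A₅ = B₁ + B₂ + B₃) (hC : u₁ + u₂ + u₃ + u₄ + u₅ = v₁ + v₂ + v₃)
    (hP1 : (A₁ ^ 2 * u₁ + A₂ ^ 2 * u₂ + A₃ ^ 2 * u₃ + A₄ ^ 2 * u₄ + A₅ ^ 2 * u₅) - (B₁ ^ 2 * v₁ + B₂ ^ 2 * v₂ + B₃ ^ 2 * v₃) = 0)
    (hP2 : (A₁ * u₁ ^ 2 + A₂ * u₂ ^ 2 + A₃ * u₃ ^ 2 + A₄ * u₄ ^ 2 + A₅ * u₅ ^ 2) - (B₁ * v₁ ^ 2 + B₂ * v₂ ^ 2 + B₃ * v₃ ^ 2) = 0)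
    (m₁₁ : |u₁ - v₁| ≤ A₁ - B₁) (m₂₁ : |u₂ - v₁| ≤ A₂ - B₁) (m₃₁ : |u₃ - v₁| ≤ A₃ - B₁) (m₄₁ : |u₄ - v₁| ≤ A₄ - B₁) (m₅₁ : |u₅ - v₁| ≤ A₅ - B₁)
    (m₁₂ : |u₁ - v₂| ≤ A₁ - B₂) (m₂₂ : |u₂ - v₂| ≤ A₂ - B₂) (m₃₂ : |u₃ - v₂| ≤ A₃ - B₂) (m₄₂ : |u₄ - v₂| ≤ A₄ - B₂) (m₅₂ : |u₅ - v₂| ≤ A₅ - B₂)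
    (m₁₃ : |u₁ - v₃| ≤ A₁ - B₃) (m₂₃ : |u₂ - v₃| ≤ A₂ - B₃) (m₃₃ : |u₃ - v₃| ≤ A₃ - B₃) (m₄₃ : |u₄ - v₃| ≤ A₄ - B₃) (m₅₃ : |u₅ - v₃| ≤ A₅ - B₃)
    :
    0 ≤ (1 / 2) * ((A₁ ^ 2 + A₂ ^ 2 + A₃ ^ 2 + A₄ ^ 2 + A₅ ^ 2) - (B₁ ^ 2 + B₂ ^ 2 + B₃ ^ 2)) * ((u₁ ^ 2 + u₂ ^ 2 + u₃ ^ 2 + u₄ ^ 2 + u₅ ^ 2) - (v₁ ^ 2 + v₂ ^ 2 + v₃ ^ 2))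
        + ((A₁ * u₁ + A₂ * u₂ + A₃ * u₃ + A₄ * u₄ + A₅ * u₅) - (B₁ * v₁ + B₂ * v₂ + B₃ * v₃)) ^ 2
        - 3 * ((A₁ ^ 2 * u₁ ^ 2 + A₂ ^ 2 * u₂ ^ 2 + A₃ ^ 2 * u₃ ^ 2 + A₄ ^ 2 * u₄ ^ 2 + A₅ ^ 2 * u₅ ^ 2) - (B₁ ^ 2 * v₁ ^ 2 + B₂ ^ 2 * v₂ ^ 2 + B₃ ^ 2 * v₃ ^ 2)) :=
  Q2_nonneg_53 A₁ A₂ A₃ A₄ A₅ B₁ B₂ B₃ u₁ u₂ u₃ u₄ u₅ v₁ v₂ v₃ hA hC hP1 hP2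
    (sub_nonneg.mp <| (abs_nonneg _).trans m₁₁) (sub_nonneg.mp <| (abs_nonneg _).trans m₂₁) (sub_nonneg.mp <| (abs_nonneg _).trans m₃₁) (sub_nonneg.mp <| (abs_nonneg _).trans m₄₁) (sub_nonneg.mp <| (abs_nonneg _).trans m₅₁)
    (sub_nonneg.mp <| (abs_nonneg _).trans m₁₂) (sub_nonneg.mp <| (abs_nonneg _).trans m₂₂) (sub_nonneg.mp <| (abs_nonneg _).trans m₃₂) (sub_nonneg.mp <| (abs_nonneg _).trans m₄₂) (sub_nonneg.mp <| (abs_nonneg _).trans m₅₂)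
    (sub_nonneg.mp <| (abs_nonneg _).trans m₁₃) (sub_nonneg.mp <| (abs_nonneg _).trans m₂₃) (sub_nonneg.mp <| (abs_nonneg _).trans m₃₃) (sub_nonneg.mp <| (abs_nonneg _).trans m₄₃) (sub_nonneg.mp <| (abs_nonneg _).trans m₅₃)

/-- **CONJECTURE N IN FORMAT (5,3) ON THE HALF `Q₄ ≥ 0`.** A centred, pure ((P1), (P2)), pairwise-ample real (5,3) configuration with
`Q₄ ≥ 0` has `Q₂ + λ·Q₄ ≥ 0` for every `λ ≥ 0` ((P4) is not needed on this half). -/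
theorem conjectureN_53_of_Q4_nonneg (A₁ A₂ A₃ A₄ A₅ B₁ B₂ B₃ u₁ u₂ u₃ u₄ u₅ v₁ v₂ v₃ : ℝ)
    (hA : A₁ + A₂ + A₃ + A₄ + A₅ = B₁ + B₂ + B₃) (hC : u₁ + u₂ + u₃ + u₄ + u₅ = v₁ + v₂ + v₃)
    (hP1 : (A₁ ^ 2 * u₁ + A₂ ^ 2 * u₂ + A₃ ^ 2 * u₃ + A₄ ^ 2 * u₄ + A₅ ^ 2 * u₅) - (B₁ ^ 2 * v₁ + B₂ ^ 2 * v₂ + B₃ ^ 2 * v₃) = 0)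
    (hP2 : (A₁ * u₁ ^ 2 + A₂ * u₂ ^ 2 + A₃ * u₃ ^ 2 + A₄ * u₄ ^ 2 + A₅ * u₅ ^ 2) - (B₁ * v₁ ^ 2 + B₂ * v₂ ^ 2 + B₃ * v₃ ^ 2) = 0)
    (m₁₁ : |u₁ - v₁| ≤ A₁ - B₁) (m₂₁ : |u₂ - v₁| ≤ A₂ - B₁) (m₃₁ : |u₃ - v₁| ≤ A₃ - B₁) (m₄₁ : |u₄ - v₁| ≤ A₄ - B₁) (m₅₁ : |u₅ - v₁| ≤ A₅ - B₁)
    (m₁₂ : |u₁ - v₂| ≤ A₁ - B₂) (m₂₂ : |u₂ - v₂| ≤ A₂ - B₂) (m₃₂ : |u₃ - v₂| ≤ A₃ - B₂) (m₄₂ : |u₄ - v₂| ≤ A₄ - B₂) (m₅₂ : |u₅ - v₂| ≤ A₅ - B₂)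
    (m₁₃ : |u₁ - v₃| ≤ A₁ - B₃) (m₂₃ : |u₂ - v₃| ≤ A₂ - B₃) (m₃₃ : |u₃ - v₃| ≤ A₃ - B₃) (m₄₃ : |u₄ - v₃| ≤ A₄ - B₃) (m₅₃ : |u₅ - v₃| ≤ A₅ - B₃)
    (hQ4 : 0 ≤ 3 * ((u₁ ^ 4 + u₂ ^ 4 + u₃ ^ 4 + u₄ ^ 4 + u₅ ^ 4) - (v₁ ^ 4 + v₂ ^ 4 + v₃ ^ 4)) - (3 / 2) * ((u₁ ^ 2 + u₂ ^ 2 + u₃ ^ 2 + u₄ ^ 2 + u₅ ^ 2) - (v₁ ^ 2 + v₂ ^ 2 + v₃ ^ 2)) ^ 2)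
    (l : ℝ) (hl : 0 ≤ l) :
    0 ≤ (1 / 2) * ((A₁ ^ 2 + A₂ ^ 2 + A₃ ^ 2 + A₄ ^ 2 + A₅ ^ 2) - (B₁ ^ 2 + B₂ ^ 2 + B₃ ^ 2)) * ((u₁ ^ 2 + u₂ ^ 2 + u₃ ^ 2 + u₄ ^ 2 + u₅ ^ 2) - (v₁ ^ 2 + v₂ ^ 2 + v₃ ^ 2))
        + ((A₁ * u₁ + A₂ * u₂ + A₃ * u₃ + A₄ * u₄ + A₅ * u₅) - (B₁ * v₁ + B₂ * v₂ + B₃ * v₃)) ^ 2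
        - 3 * ((A₁ ^ 2 * u₁ ^ 2 + A₂ ^ 2 * u₂ ^ 2 + A₃ ^ 2 * u₃ ^ 2 + A₄ ^ 2 * u₄ ^ 2 + A₅ ^ 2 * u₅ ^ 2) - (B₁ ^ 2 * v₁ ^ 2 + B₂ ^ 2 * v₂ ^ 2 + B₃ ^ 2 * v₃ ^ 2))
      + l * (3 * ((u₁ ^ 4 + u₂ ^ 4 + u₃ ^ 4 + u₄ ^ 4 + u₅ ^ 4) - (v₁ ^ 4 + v₂ ^ 4 + v₃ ^ 4)) - (3 / 2) * ((u₁ ^ 2 + u₂ ^ 2 + u₃ ^ 2 + u₄ ^ 2 + u₅ ^ 2) - (v₁ ^ 2 + v₂ ^ 2 + v₃ ^ 2)) ^ 2) := by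
  have hQ2 := Q2_nonneg_53_ample A₁ A₂ A₃ A₄ A₅ B₁ B₂ B₃ u₁ u₂ u₃ u₄ u₅ v₁ v₂ v₃ hA hC hP1 hP2
    m₁₁ m₂₁ m₃₁ m₄₁ m₅₁ m₁₂ m₂₂ m₃₂ m₄₂ m₅₂ m₁₃ m₂₃ m₃₃ m₄₃ m₅₃
  exact add_nonneg hQ2 (mul_nonneg hl hQ4)

end Summit.HodgeConjecture.HodgeConjecture.WeilClassTestFormatFiveThreeQ2
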